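import Summits.NavierStokesRegularity.NavierStokesRegularity.Theses.TypeILiouville
import Summits.NavierStokesRegularity.NavierStokesRegularity.Theorems.TypeILiouvilleTypeIliouvilleNoTypeIIGradientPivot
import Mathlib.MeasureTheory.Measure.Lebesgue.EqHaar
import Mathlib.MeasureTheory.Measure.Haar.InnerProductSpace
import HarnessLib

/-!
# No fast parabolic balls: `NoTypeII ⇔ GradientBKMSharp ∧ NoFastBalls`
# (crux `TypeIliouvilleNoTypeII`, stmt-NavierStokesRegularity-0056, line `Sketch`
# (gradient-bkm-pivot), skeleton rev 4, stub `stub_typeI_of_noFastBalls` and its dictionary)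

Helper file (theorems only) of pass c2 of the crux protocol.  Revision 4 of the skeleton
`Cruxes/TypeIliouvilleNoTypeII/Lines/gradient_bkm_pivot.lean` reshapes the fine-structure residual
of the line (`stub_windowTypeI`: gradient-sharp and `(T - t)^{-3/5}`-bounded ⇒ Type I) into

* its open core `stub_noFastBalls` (B1): under BKM-sharpness of the gradient, near `T` every ball
  of parabolic radius `√(T - t)` contains a point `y` of Type-I speed `‖u(t, y)‖ ≤ K/√(T - t)` —
  the typed negation of the "fat boost blob" of the card (idea gradient-bkm-pivot,
  §Why-it-bites (3)); and
* the provable shell `stub_typeI_of_noFastBalls` (this file): gradient sharpness and B1 give the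
  Type-I rate by the mean-value inequality on the convex ball,
  `‖u(t, x)‖ ≤ ‖u(t, y)‖ + √(T - t) · C₁/(T - t) ≤ (K + C₁)/√(T - t)`.

Dictionary (all proved here):

* `noFastBalls_of_isTypeIBlowup` — B1 is necessary for the crux (`y = x`);
* `TypeIliouvilleNoTypeII_iff_gradientSharp_and_noFastBalls` — **`NoTypeII ⇔ A ∧ B1`** with
  A = `GradientBKMSharp` (residual `stub_gradientBKMSharp`, necessary by the landed
  `gradientSharp_of_noTypeII`), both conjuncts quantified over the crux's exact hypotheses;
* `noFastBalls_of_scaledEnergy` — a uniform Type-I bound on Seregin's scaled local energies,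
  `∫_{B(x, √(T - t))} ‖u(t)‖² ≤ K √(T - t)` for all centres `x` ("Type I in the energy sense",
  Seregin 2012 §1 (1.6) with the centre free), implies B1;
* `noFastBalls_of_ballIntegral` — so does a Type-I bound on parabolic ball integrals of the speed,
  `∫_{B(x, √(T - t))} ‖u(t)‖ ≤ K (T - t)`;
* `noTypeII_of_gradientSharp_of_scaledEnergyTypeI` — hence A together with scaled-energy Type I
  for gradient-sharp solutions already gives the crux.

So on the gradient-sharp side the whole open content of `NoTypeII` is ONE slow point per parabolic
ball, and every averaged Type-I statement at the parabolic scale discharges it.  Nothing here uses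
the energy class beyond what the hypotheses of the crux carry; `stub_typeI_of_noFastBalls` itself
uses neither finite energy nor maximality (only differentiability of the slices).
-/

noncomputable section

-- the summit and its single problem share the name (D-0017 nested layout)
set_option linter.dupNamespace false

open Set Function Filter Topology MeasureTheory Metric
open scoped NNReal ENNReal

namespace Summit.NavierStokesRegularity.NavierStokesRegularity.Theorems.TypeIliouvilleNoTypeII.GradientPivot

open Literature.Analysis Literature.Analysis.FluidPDE

/-- `ℝ³`. -/
local notation "E3" => EuclideanSpace ℝ (Fin 3)

/-! ## The mean-value step -/

/-- **Pointwise form.**  If `v : ℝ³ → ℝ³` is differentiable with `‖fderiv v‖ ≤ L` everywhere,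
`0 ≤ L`, and the ball `B(x, r)` contains a point `y` with `‖v y‖ ≤ b`, then
`‖v x‖ ≤ b + L r` (mean-value inequality on the convex ball). [folklore] -/
theorem norm_le_of_exists_mem_ball {v : E3 → E3} {L r b : ℝ} {x : E3} (hv : Differentiable ℝ v)
    (hL : ∀ z, ‖fderiv ℝ v z‖ ≤ L) (hL0 : 0 ≤ L) (hy : ∃ y ∈ ball x r, ‖v y‖ ≤ b) :
    ‖v x‖ ≤ b + L * r := by
  obtain ⟨y, hy, hyb⟩ := hy
  have hr : 0 < r := lt_of_le_of_lt dist_nonneg (mem_ball.1 hy)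
  have hmv : ‖v y - v x‖ ≤ L * ‖y - x‖ :=
    (convex_ball x r).norm_image_sub_le_of_norm_fderiv_le (fun z _ => hv.differentiableAt)
      (fun z _ => hL z) (mem_ball_self hr) hy
  have hyx : ‖y - x‖ ≤ r := (mem_ball_iff_norm.1 hy).le
  calc ‖v x‖ ≤ ‖v y‖ + ‖v y - v x‖ := norm_le_norm_add_norm_sub (v y) (v x)
    _ ≤ b + L * r := add_le_add hyb (hmv.trans (mul_le_mul_of_nonneg_left hyx hL0))

/-- **No fast parabolic balls + BKM-sharp gradient ⇒ Type I.**  For a classical solution on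
`[0, T)`, `0 < T`, gradient sharpness `‖∇u(t)‖ ≤ C₁/(T - t)` near `T` and one slow point
`‖u(t, y)‖ ≤ K/√(T - t)` in every ball `B(x, √(T - t))` near `T` give
`‖u(t, x)‖ ≤ (K + max C₁ 0)/√(T - t)` near `T`. [folklore] -/
theorem isTypeIBlowup_of_noFastBalls {ν T : ℝ} (hT : 0 < T) {u : ℝ → E3 → E3} {p : ℝ → E3 → ℝ}
    (hsol : IsClassicalNSSolutionOn (Ico 0 T) ν 0 u p)
    (hG : ∃ C₁ : ℝ, ∀ᶠ t in 𝓝[<] T, ∀ x, ‖fderiv ℝ (u t) x‖ ≤ C₁ / (T - t))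
    (hB : ∃ K : ℝ, ∀ᶠ t in 𝓝[<] T, ∀ x : E3, ∃ y ∈ ball x (Real.sqrt (T - t)),
      ‖u t y‖ ≤ K / Real.sqrt (T - t)) :
    IsTypeIBlowup u T := by
  obtain ⟨C₁, hC₁⟩ := hG
  obtain ⟨K, hK⟩ := hB
  refine ⟨K + max C₁ 0, ?_⟩
  filter_upwards [hC₁, hK, Ico_mem_nhdsLT hT] with t ht hKt htI x
  have hTt : 0 < T - t := sub_pos.2 htI.2
  have hr0 : 0 < Real.sqrt (T - t) := Real.sqrt_pos.2 hTt
  have hrr : Real.sqrt (T - t) * Real.sqrt (T - t) = T - t := Real.mul_self_sqrt hTt.le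
  have hdiff : Differentiable ℝ (u t) :=
    (hsol.contDiff_velocity htI).differentiable (by simp)
  have hL0 : 0 ≤ max C₁ 0 / (T - t) := div_nonneg (le_max_right _ _) hTt.le
  have hL : ∀ z, ‖fderiv ℝ (u t) z‖ ≤ max C₁ 0 / (T - t) := fun z =>
    (ht z).trans (div_le_div_of_nonneg_right (le_max_left _ _) hTt.le)
  have key := norm_le_of_exists_mem_ball hdiff hL hL0 (hKt x)
  have h2 : max C₁ 0 / (T - t) * Real.sqrt (T - t) = max C₁ 0 / Real.sqrt (T - t) := by
    rw [eq_div_iff hr0.ne', mul_assoc, hrr, div_mul_cancel₀ _ hTt.ne']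
  calc ‖u t x‖ ≤ K / Real.sqrt (T - t) + max C₁ 0 / (T - t) * Real.sqrt (T - t) := key
    _ = (K + max C₁ 0) / Real.sqrt (T - t) := by rw [h2, add_div]

/-! ## Dictionary: `NoTypeII ⇔ GradientBKMSharp ∧ NoFastBalls` -/

/-- **B1 is necessary**: a Type-I blow-up has no fast parabolic balls (take `y = x`). [folklore] -/
theorem noFastBalls_of_isTypeIBlowup {T : ℝ} (hT : 0 < T) {u : ℝ → E3 → E3}
    (hI : IsTypeIBlowup u T) :
    ∃ K : ℝ, ∀ᶠ t in 𝓝[<] T, ∀ x : E3, ∃ y ∈ ball x (Real.sqrt (T - t)),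
      ‖u t y‖ ≤ K / Real.sqrt (T - t) := by
  obtain ⟨C₀, hC₀⟩ := hI
  refine ⟨C₀, ?_⟩
  filter_upwards [hC₀, Ico_mem_nhdsLT hT] with t ht htI x
  exact ⟨x, mem_ball_self (Real.sqrt_pos.2 (sub_pos.2 htI.2)), ht x⟩

/-- **`NoTypeII ⇔ GradientBKMSharp ∧ NoFastBalls`** (both conjuncts quantified over the crux's
exact hypotheses): `→` by the landed `gradientSharp_of_noTypeII` (KNSS §4 bootstrap at the Type-I
scale) and `noFastBalls_of_isTypeIBlowup`; `←` by `isTypeIBlowup_of_noFastBalls`.  The crux is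
thus closed MODULO the two registered residuals `stub_gradientBKMSharp` (A) and
`stub_noFastBalls` (B1) of the skeleton rev 4, and each is necessary. [folklore] -/
theorem TypeIliouvilleNoTypeII_iff_gradientSharp_and_noFastBalls :
    Summit.NavierStokesRegularity.NavierStokesRegularity.Theses.TypeILiouville.TypeIliouvilleNoTypeII ↔
      ((∀ (ν T : ℝ), 0 < ν → 0 < T → ∀ (u : ℝ → E3 → E3) (p : ℝ → E3 → ℝ),
          IsMaximalSmoothSolution ν 0 u p T → IsLerayHopfOn T ν 0 (u 0) u →
          HasRapidSpatialDecay (u 0) →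
          ∃ C : ℝ, ∀ᶠ t in 𝓝[<] T, ∀ x, ‖fderiv ℝ (u t) x‖ ≤ C / (T - t)) ∧
        (∀ (ν T : ℝ), 0 < ν → 0 < T → ∀ (u : ℝ → E3 → E3) (p : ℝ → E3 → ℝ),
          IsMaximalSmoothSolution ν 0 u p T → IsLerayHopfOn T ν 0 (u 0) u →
          HasRapidSpatialDecay (u 0) →
          (∃ C₁ : ℝ, ∀ᶠ t in 𝓝[<] T, ∀ x, ‖fderiv ℝ (u t) x‖ ≤ C₁ / (T - t)) →
          ∃ K : ℝ, ∀ᶠ t in 𝓝[<] T, ∀ x : E3, ∃ y ∈ ball x (Real.sqrt (T - t)),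
            ‖u t y‖ ≤ K / Real.sqrt (T - t))) := by
  constructor
  · intro h
    exact ⟨gradientSharp_of_noTypeII h, fun ν T hν hT u p hmax hLH hdec _ =>
      noFastBalls_of_isTypeIBlowup hT (h ν T hν hT u p hmax hLH hdec)⟩
  · rintro ⟨hA, hB1⟩ ν T hν hT u p hmax hLH hdec
    have hG := hA ν T hν hT u p hmax hLH hdec
    exact isTypeIBlowup_of_noFastBalls hT hmax.1 hG (hB1 ν T hν hT u p hmax hLH hdec hG)

/-! ## Averaged Type-I statements at the parabolic scale discharge B1 -/

/-- **A fast ball carries much of an integrand bounded below.**  If `f : ℝ³ → ℝ` is continuous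
and `c ≤ f` on `B(x, r)`, `0 ≤ r`, then `c · r³ |B(0,1)| ≤ ∫_{B(x, r)} f` (ball volume
`|B(x, r)| = r³ |B(0,1)|` by the landed `threeFifthsGrad_volume_ball_toReal`). [folklore] -/
theorem const_mul_volume_le_setIntegral_ball {f : E3 → ℝ} (hf : Continuous f) (x : E3) {r c : ℝ}
    (hr : 0 ≤ r) (hcf : ∀ y ∈ ball x r, c ≤ f y) :
    c * (r ^ 3 * (volume (ball (0 : E3) 1)).toReal) ≤ ∫ y in ball x r, f y := by
  have hfi : IntegrableOn f (ball x r) volume :=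
    (hf.continuousOn.integrableOn_compact (isCompact_closedBall x r)).mono_set
      ball_subset_closedBall
  have hci : IntegrableOn (fun _ : E3 => c) (ball x r) volume :=
    integrableOn_const (hs := measure_ball_lt_top.ne)
  calc c * (r ^ 3 * (volume (ball (0 : E3) 1)).toReal)
        = ∫ _ in ball x r, c := by
          rw [setIntegral_const, smul_eq_mul, measureReal_def, threeFifthsGrad_volume_ball_toReal x hr,
            mul_comm]
    _ ≤ ∫ y in ball x r, f y := setIntegral_mono_on hci hfi measurableSet_ball hcf

/-- **Scaled-energy Type I ⇒ no fast parabolic balls.**  For a classical solution on `[0, T)`,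
`0 < T`, a uniform Type-I bound on Seregin's scaled local energies at the parabolic scale,
`∫_{B(x, √(T - t))} ‖u(t)‖² ≤ K √(T - t)` for all `x` and all `t < T` near `T`, forces a slow
point in every such ball: if all of `B(x, √(T - t))` were faster than `K'/√(T - t)` the ball
would carry energy `≥ K'² |B(0,1)| √(T - t) > K √(T - t)` once `K'² |B(0,1)| > K`.
[cite: Seregin2012, §1 (1.6)] -/
theorem noFastBalls_of_scaledEnergy {ν T : ℝ} (hT : 0 < T) {u : ℝ → E3 → E3} {p : ℝ → E3 → ℝ}
    (hsol : IsClassicalNSSolutionOn (Ico 0 T) ν 0 u p)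
    (hE : ∃ K : ℝ, ∀ᶠ t in 𝓝[<] T, ∀ x : E3,
      ∫ y in ball x (Real.sqrt (T - t)), ‖u t y‖ ^ 2 ≤ K * Real.sqrt (T - t)) :
    ∃ K' : ℝ, ∀ᶠ t in 𝓝[<] T, ∀ x : E3, ∃ y ∈ ball x (Real.sqrt (T - t)),
      ‖u t y‖ ≤ K' / Real.sqrt (T - t) := by
  obtain ⟨K, hK⟩ := hE
  set ω : ℝ := (volume (ball (0 : E3) 1)).toReal with hω
  have hω0 : 0 < ω :=
    ENNReal.toReal_pos (measure_ball_pos volume (0 : E3) one_pos).ne' measure_ball_lt_top.ne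
  -- the threshold `K'` with `K'² ω > max K 0`
  set K' : ℝ := Real.sqrt (max K 0 / ω) + 1 with hK'
  have hs0 : 0 ≤ Real.sqrt (max K 0 / ω) := Real.sqrt_nonneg _
  have hK'0 : 0 < K' := by rw [hK']; linarith
  have hbig : max K 0 < K' ^ 2 * ω := by
    have h1 : Real.sqrt (max K 0 / ω) ^ 2 = max K 0 / ω :=
      Real.sq_sqrt (div_nonneg (le_max_right _ _) hω0.le)
    have h2 : Real.sqrt (max K 0 / ω) ^ 2 < K' ^ 2 := by
      rw [hK']; nlinarith
    have h3 : max K 0 / ω < K' ^ 2 := h1 ▸ h2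
    rwa [div_lt_iff₀ hω0] at h3
  refine ⟨K', ?_⟩
  filter_upwards [hK, Ico_mem_nhdsLT hT] with t ht htI x
  have hTt : 0 < T - t := sub_pos.2 htI.2
  set r : ℝ := Real.sqrt (T - t) with hr
  have hr0 : 0 < r := Real.sqrt_pos.2 hTt
  have hrr : r ^ 2 = T - t := Real.sq_sqrt hTt.le
  by_contra hfast
  push Not at hfast
  -- every point of the ball is fast: `K'² / (T - t) ≤ ‖u t y‖²` on `B(x, r)`
  have hlow : ∀ y ∈ ball x r, K' ^ 2 / (T - t) ≤ ‖u t y‖ ^ 2 := fun y hy => by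
    have h1 : K' / r < ‖u t y‖ := hfast y hy
    have h2 : (K' / r) ^ 2 ≤ ‖u t y‖ ^ 2 :=
      pow_le_pow_left₀ (div_nonneg hK'0.le hr0.le) h1.le 2
    rwa [div_pow, hrr] at h2
  have hcont : Continuous fun y => ‖u t y‖ ^ 2 :=
    ((hsol.contDiff_velocity htI).continuous.norm).pow 2
  have hint := const_mul_volume_le_setIntegral_ball hcont x hr0.le hlow
  -- `K'² ω r³/(T - t) = K'² ω r ≤ K r`, contradicting `K < K'² ω`
  have h3 : K' ^ 2 / (T - t) * (r ^ 3 * ω) = K' ^ 2 * ω * r := by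
    rw [← hrr]
    field_simp
  have h4 : K' ^ 2 * ω * r ≤ K * r := by
    have := hint.trans (ht x)
    rwa [h3] at this
  have h5 : K' ^ 2 * ω ≤ K := le_of_mul_le_mul_right h4 hr0
  linarith [le_max_left K 0]

/-- **Ball-integral Type I ⇒ no fast parabolic balls.**  For a classical solution on `[0, T)`,
`0 < T`, a Type-I bound on the parabolic ball integrals of the speed,
`∫_{B(x, √(T - t))} ‖u(t)‖ ≤ K (T - t)` for all `x` and all `t < T` near `T` (equivalently: the
ball AVERAGES of `‖u(t)‖` are `≤ K'/√(T - t)`), forces a slow point in every such ball.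
[folklore] -/
theorem noFastBalls_of_ballIntegral {ν T : ℝ} (hT : 0 < T) {u : ℝ → E3 → E3} {p : ℝ → E3 → ℝ}
    (hsol : IsClassicalNSSolutionOn (Ico 0 T) ν 0 u p)
    (hA : ∃ K : ℝ, ∀ᶠ t in 𝓝[<] T, ∀ x : E3,
      ∫ y in ball x (Real.sqrt (T - t)), ‖u t y‖ ≤ K * (T - t)) :
    ∃ K' : ℝ, ∀ᶠ t in 𝓝[<] T, ∀ x : E3, ∃ y ∈ ball x (Real.sqrt (T - t)),
      ‖u t y‖ ≤ K' / Real.sqrt (T - t) := by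
  obtain ⟨K, hK⟩ := hA
  set ω : ℝ := (volume (ball (0 : E3) 1)).toReal with hω
  have hω0 : 0 < ω :=
    ENNReal.toReal_pos (measure_ball_pos volume (0 : E3) one_pos).ne' measure_ball_lt_top.ne
  -- the threshold `K'` with `K' ω > max K 0`
  set K' : ℝ := max K 0 / ω + 1 with hK'
  have hbig : max K 0 < K' * ω := by
    rw [hK', add_mul, div_mul_cancel₀ _ hω0.ne']
    linarith
  refine ⟨K', ?_⟩
  filter_upwards [hK, Ico_mem_nhdsLT hT] with t ht htI x
  have hTt : 0 < T - t := sub_pos.2 htI.2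
  set r : ℝ := Real.sqrt (T - t) with hr
  have hr0 : 0 < r := Real.sqrt_pos.2 hTt
  have hrr : r ^ 2 = T - t := Real.sq_sqrt hTt.le
  by_contra hfast
  push Not at hfast
  have hlow : ∀ y ∈ ball x r, K' / r ≤ ‖u t y‖ := fun y hy => (hfast y hy).le
  have hcont : Continuous fun y => ‖u t y‖ := (hsol.contDiff_velocity htI).continuous.norm
  have hint := const_mul_volume_le_setIntegral_ball hcont x hr0.le hlow
  -- `K' ω r³ / r = K' ω r² ≤ K (T - t) = K r²`, contradicting `K < K' ω`
  have h3 : K' / r * (r ^ 3 * ω) = K' * ω * r ^ 2 := by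
    field_simp
  have h4 : K' * ω * r ^ 2 ≤ K * r ^ 2 := by
    have := hint.trans (ht x)
    rwa [h3, ← hrr] at this
  have h5 : K' * ω ≤ K := le_of_mul_le_mul_right h4 (by positivity)
  linarith [le_max_left K 0]

/-- **GradientBKMSharp ∧ scaled-energy Type I ⇒ `NoTypeII`.**  If every maximal Leray–Hopf
solution from a rapidly decaying datum is gradient-sharp (residual A), and every gradient-sharp
one obeys a uniform Type-I bound on its scaled local energies at the parabolic scale ("Type I in
the energy sense", centre free), the crux holds (`noFastBalls_of_scaledEnergy` +
`isTypeIBlowup_of_noFastBalls`). [folklore] -/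
theorem noTypeII_of_gradientSharp_of_scaledEnergyTypeI
    (hA : ∀ (ν T : ℝ), 0 < ν → 0 < T → ∀ (u : ℝ → E3 → E3) (p : ℝ → E3 → ℝ),
      IsMaximalSmoothSolution ν 0 u p T → IsLerayHopfOn T ν 0 (u 0) u →
      HasRapidSpatialDecay (u 0) →
      ∃ C : ℝ, ∀ᶠ t in 𝓝[<] T, ∀ x, ‖fderiv ℝ (u t) x‖ ≤ C / (T - t))
    (hE : ∀ (ν T : ℝ), 0 < ν → 0 < T → ∀ (u : ℝ → E3 → E3) (p : ℝ → E3 → ℝ),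
      IsMaximalSmoothSolution ν 0 u p T → IsLerayHopfOn T ν 0 (u 0) u →
      HasRapidSpatialDecay (u 0) →
      (∃ C₁ : ℝ, ∀ᶠ t in 𝓝[<] T, ∀ x, ‖fderiv ℝ (u t) x‖ ≤ C₁ / (T - t)) →
      ∃ K : ℝ, ∀ᶠ t in 𝓝[<] T, ∀ x : E3,
        ∫ y in ball x (Real.sqrt (T - t)), ‖u t y‖ ^ 2 ≤ K * Real.sqrt (T - t)) :
    Summit.NavierStokesRegularity.NavierStokesRegularity.Theses.TypeILiouville.TypeIliouvilleNoTypeII := by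
  intro ν T hν hT u p hmax hLH hdec
  have hG := hA ν T hν hT u p hmax hLH hdec
  exact isTypeIBlowup_of_noFastBalls hT hmax.1 hG
    (noFastBalls_of_scaledEnergy hT hmax.1 (hE ν T hν hT u p hmax hLH hdec hG))

/-! ## Registered stub -/

/-- **Registered stub `stub_typeI_of_noFastBalls` of the skeleton
`Cruxes/TypeIliouvilleNoTypeII/Lines/gradient_bkm_pivot.lean` (rev 4).**  For a classical solution
on `[0, T)`, `0 < T`, BKM-sharpness of the gradient near `T` and the no-fast-parabolic-balls
property near `T` imply the Type-I rate (`isTypeIBlowup_of_noFastBalls`). [folklore] -/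
theorem stub_typeI_of_noFastBalls (ν T : ℝ) (hT : 0 < T) (u : ℝ → E3 → E3) (p : ℝ → E3 → ℝ)
    (hsol : IsClassicalNSSolutionOn (Ico 0 T) ν 0 u p)
    (hG : ∃ C₁ : ℝ, ∀ᶠ t in 𝓝[<] T, ∀ x, ‖fderiv ℝ (u t) x‖ ≤ C₁ / (T - t))
    (hB : ∃ K : ℝ, ∀ᶠ t in 𝓝[<] T, ∀ x : E3, ∃ y ∈ ball x (Real.sqrt (T - t)),
      ‖u t y‖ ≤ K / Real.sqrt (T - t)) :
    IsTypeIBlowup u T :=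
  isTypeIBlowup_of_noFastBalls hT hsol hG hB

end Summit.NavierStokesRegularity.NavierStokesRegularity.Theorems.TypeIliouvilleNoTypeII.GradientPivot

end
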